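import Mathlib
import Summits.ValiantsHypothesis.ValiantsHypothesis.Theorems.LacunarySymmetroidMatrixDescartesDefiniteMomentsRayleigh
import Summits.ValiantsHypothesis.ValiantsHypothesis.Theorems.LacunarySymmetroidMatrixDescartesDefiniteMomentsWordPoints

/-!
# `MatrixDescartes` (stmt-ValiantsHypothesis-18050) — the DEFINITE-MOMENTS LAW, sign-word form: every zero of a Rayleigh
# form is a FORCED GAP ZERO (budget saturation along `0⁺, t₀, …, t_N, +∞`)

HONEST FRAMING.  Cell `pub-symmetroid`, seat `val-sym-mdr-p2` (gen 14); helper file `--supports` the crux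
`Theses.LacunarySymmetroid.MatrixDescartes`, NO closure claim; the scalar accounting half of the sign-word law (light re-cut
of `…DefiniteMomentsWordData`).  Nothing here bears on the crux in its window, on `stub_twoSided`, on `DoorA26`/`DoorA34`,
registers, or `VP ≠ VNP`.

SETTING.  `F(x) = ∑ₖ x^{dₖ} Sₖ`, real symmetric letters; a semidefinite sign word given by a monotone block index `β : ℕ → ℕ`
on exponents, `β ≤ N + 2`, `(−1)^{β(dₖ)} Sₖ ⪰ 0`; interior moments `0 < t₀ < ⋯ < t_N` with `(−1)^{j+1} F(tⱼ) ≻ 0`.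
THEOREM (`wordZeros`).  For every `v ≠ 0` there are a point `u ∈ (0, t₀)` below which `f_v = vᵀF(·)v` has the constant
sign `(−1)^{b₀}`, a point `M′ > t_N` beyond which it has the constant sign `(−1)^{b₁}`, the point sequence
`q = (u, t₀, …, t_N, M′)` and gap zeros `zᵢ`, such that EVERY positive zero of `f_v` is the zero `zᵢ` of a SIGN-CHANGING
gap `(qᵢ, qᵢ₊₁)`.  Proof: the Rayleigh K-nomial's Descartes budget «last visible block − first visible block»
(`rayleigh_word_budget`) is at most the number of sign changes along `q` (`changingGaps_bound`), so `zeros_in_changing_gaps`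
applies.  [folklore]; axioms `propext`, `Classical.choice`, `Quot.sound`; no definitions.
-/

-- layout Summits/ValiantsHypothesis/ValiantsHypothesis forces the duplicated namespace component
set_option linter.dupNamespace false

namespace Summit.ValiantsHypothesis.ValiantsHypothesis.Theorems.LacunarySymmetroidMatrixDescartes

open Polynomial Matrix Finset
open scoped BigOperators

namespace DefiniteMoments

section WordZeros

variable {ι κ : Type} [Fintype ι] [Fintype κ]

/-- **Every zero of a Rayleigh form of a sign word with interior definite moments is a forced gap zero** (see the
module docstring for the data returned). [folklore] -/
theorem wordZeros (d : κ → ℕ) (S : κ → Matrix ι ι ℝ) (β : ℕ → ℕ) (hβ : Monotone β) (N : ℕ)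
    (hβN : ∀ n, β n ≤ N + 2) (hsign : ∀ k, (((-1 : ℝ) ^ β (d k)) • S k).PosSemidef)
    (t : Fin (N + 1) → ℝ) (ht : StrictMono t) (ht0 : 0 < t 0)
    (hdef : ∀ (j : Fin (N + 1)) (v : ι → ℝ), v ≠ 0 →
      0 < (-1 : ℝ) ^ ((j : ℕ) + 1) * (v ⬝ᵥ ((∑ k, t j ^ d k • S k) *ᵥ v)))
    (v : ι → ℝ) (hv : v ≠ 0) :
    ∃ (u M' δ M : ℝ) (b₀ b₁ : ℕ) (q : Fin (N + 2 + 1) → ℝ) (z : Fin (N + 2) → ℝ),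
      StrictMono q ∧ 0 < u ∧ u < δ ∧ u < t 0 ∧ M < M' ∧ t (Fin.last N) < M' ∧
      (∀ i : Fin (N + 2 + 1), (i : ℕ) = 0 → q i = u) ∧
      (∀ (i : Fin (N + 2 + 1)) (j : Fin (N + 1)), (i : ℕ) = (j : ℕ) + 1 → q i = t j) ∧
      (∀ i : Fin (N + 2 + 1), (i : ℕ) = N + 2 → q i = M') ∧
      (∀ x : ℝ, 0 < x → x < δ → 0 < (-1 : ℝ) ^ b₀ * (v ⬝ᵥ ((∑ k, x ^ d k • S k) *ᵥ v))) ∧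
      (∀ x : ℝ, M < x → 0 < (-1 : ℝ) ^ b₁ * (v ⬝ᵥ ((∑ k, x ^ d k • S k) *ᵥ v))) ∧
      (∀ i : Fin (N + 2), (v ⬝ᵥ ((∑ k, q i.castSucc ^ d k • S k) *ᵥ v)) * (v ⬝ᵥ ((∑ k, q i.succ ^ d k • S k) *ᵥ v)) < 0 →
        q i.castSucc < z i ∧ z i < q i.succ ∧ v ⬝ᵥ ((∑ k, z i ^ d k • S k) *ᵥ v) = 0) ∧
      (∀ x : ℝ, 0 < x → v ⬝ᵥ ((∑ k, x ^ d k • S k) *ᵥ v) = 0 →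
        ∃ i : Fin (N + 2), (v ⬝ᵥ ((∑ k, q i.castSucc ^ d k • S k) *ᵥ v)) *
          (v ⬝ᵥ ((∑ k, q i.succ ^ d k • S k) *ᵥ v)) < 0 ∧ x = z i) := by
  set f : ℝ → ℝ := fun x => v ⬝ᵥ ((∑ k, x ^ d k • S k) *ᵥ v) with hf
  have hfc : Continuous f := continuous_form d S v
  have hft : ∀ j : Fin (N + 1), 0 < (-1 : ℝ) ^ ((j : ℕ) + 1) * f (t j) := fun j => hdef j v hv
  have hft0 : f (t 0) < 0 := by
    have h := hft 0
    rw [Fin.val_zero, zero_add, pow_one] at h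
    linarith
  have hx₀ : v ⬝ᵥ ((∑ k, t 0 ^ d k • S k) *ᵥ v) ≠ 0 := hft0.ne
  -- the Rayleigh K-nomial, its end blocks, its end signs and its budget
  set P := ∑ k, C (v ⬝ᵥ (S k *ᵥ v)) * (X : ℝ[X]) ^ d k with hP
  set b₀ := β P.natTrailingDegree with hb₀
  set b₁ := β P.natDegree with hb₁
  have hb₁N : b₁ ≤ N + 2 := hβN _
  obtain ⟨δ, hδ, hnear⟩ := rayleigh_word_near_zero d S β hsign v hx₀
  obtain ⟨M, hM, hfar⟩ := rayleigh_word_atTop d S β hsign v hx₀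
  have hbudget : ∀ T : Finset ℝ, (∀ r ∈ T, 0 < r ∧ f r = 0) → T.card + b₀ ≤ b₁ :=
    fun T hT => rayleigh_word_budget d S β hβ hsign v hx₀ T hT
  -- the point sequence `u, t₀, …, t_N, M'`
  set u : ℝ := min δ (t 0) / 2 with hu
  have hmin : 0 < min δ (t 0) := lt_min hδ ht0
  have hu0 : 0 < u := by rw [hu]; linarith
  have huδ : u < δ := by rw [hu]; linarith [min_le_left δ (t 0)]
  have hut : u < t 0 := by rw [hu]; linarith [min_le_right δ (t 0)]
  set M' : ℝ := max M (t (Fin.last N)) + 1 with hM'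
  have hM'M : M < M' := by rw [hM']; linarith [le_max_left M (t (Fin.last N))]
  have hM't : t (Fin.last N) < M' := by rw [hM']; linarith [le_max_right M (t (Fin.last N))]
  obtain ⟨q, hqmono, hq_u, hq_t, hq_M⟩ := exists_wordPoints t ht u M' hut hM't
  have hq0pos : 0 < q 0 := by rw [hq_u 0 rfl]; exact hu0
  -- which gaps change sign
  have hchg_mid : ∀ i : Fin (N + 2), 1 ≤ (i : ℕ) → (i : ℕ) ≤ N → f (q i.castSucc) * f (q i.succ) < 0 := by
    intro i h1 h2
    rw [hq_t i.castSucc ⟨(i : ℕ) - 1, by omega⟩ (by simp; omega), hq_t i.succ ⟨(i : ℕ), by omega⟩ (by simp)]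
    have ha := hft ⟨(i : ℕ) - 1, by omega⟩
    have hb := hft ⟨(i : ℕ), by omega⟩
    have e : (i : ℕ) - 1 + 1 = (i : ℕ) := by omega
    simp only [e] at ha
    exact mul_neg_of_alt _ ha hb
  have hchg_0 : b₀ = 0 → f (q (0 : Fin (N + 2)).castSucc) * f (q (0 : Fin (N + 2)).succ) < 0 := by
    intro h
    have h1 := hnear u hu0 huδ
    rw [← hb₀, h, pow_zero, one_mul] at h1
    rw [hq_u _ (by simp), hq_t _ 0 (by simp)]
    exact mul_neg_of_pos_of_neg h1 hft0
  have hchg_L : b₁ = N + 2 → f (q (Fin.last (N + 1)).castSucc) * f (q (Fin.last (N + 1)).succ) < 0 := by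
    intro h
    have h1 := hfar M' hM'M
    rw [← hb₁, h, pow_succ] at h1
    rw [hq_t _ (Fin.last N) (by simp), hq_M _ (by simp)]
    have ha := hft (Fin.last N)
    rw [Fin.val_last] at ha
    rcases neg_one_pow_eq_or ℝ (N + 1) with h2 | h2 <;> rw [h2] at ha h1 <;> nlinarith
  have key := changingGaps_bound (fun i : Fin (N + 2) => f (q i.castSucc) * f (q i.succ) < 0) hchg_mid b₀ b₁ hb₁N
    hchg_0 hchg_L
  have hbud : ∀ T : Finset ℝ, (∀ r ∈ T, 0 < r ∧ f r = 0) →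
      T.card ≤ ((Finset.univ : Finset (Fin (N + 2))).filter
        (fun i : Fin (N + 2) => f (q i.castSucc) * f (q i.succ) < 0)).card := by
    intro T hT
    have h := hbudget T hT
    omega
  obtain ⟨z, hz, hall⟩ := zeros_in_changing_gaps hfc q hqmono hq0pos hbud
  exact ⟨u, M', δ, M, b₀, b₁, q, z, hqmono, hu0, huδ, hut, hM'M, hM't, hq_u, hq_t, hq_M,
    fun x hx hxδ => hnear x hx hxδ, fun x hx => hfar x hx, hz, hall⟩

end WordZeros

end DefiniteMoments

end Summit.ValiantsHypothesis.ValiantsHypothesis.Theorems.LacunarySymmetroidMatrixDescartes
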